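import Summits.BirchSwinnertonDyer.BirchSwinnertonDyer.Theorems.PrintCFramBottomClassIndexLawFiveLeFlipRungTransportReading
import Mathlib.Analysis.SpecialFunctions.Complex.CircleAddChar
import Mathlib.NumberTheory.LegendreSymbol.AddCharacter
import Mathlib.Algebra.Polynomial.Roots
import HarnessLib

set_option autoImplicit false

/-!
# Crux `PrintCFram.BottomClassIndexLawFiveLe` (stmt-BirchSwinnertonDyer-20372), line `eisenstein-resource-bdp-line` (registry v28):
# «T8 — THE LOWER-UNIPOTENT RUNG», piece T8-1b: THE KLOOSTERMAN WEIGHT MADE RATIONAL — fibre counts `c_j ≤ 2`, the trace identity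
# `Σ_{s≠0} ψ(−sj)·K_s(u,v) = q·c_j − (q−1)`, the pigeonhole «some `j` has `ℓ ∤ q·c_j − (q−1)`», and the `p`-adic reading
# (cell `bsd-print-cfram`, width seat `bsd-line-cfram-p1-w3` g19; THEOREMS ONLY, `--supports` 20372; BSD is not proved by any of this)

HONEST FRAMING. Finite arithmetic in `ℤ/qℤ` plus the `p`-adic reading of `…FlipRungTransport` §5; nothing here is a statement about elliptic
curves or BSD; no registered stub is closed. Context (crux notes `Lines/eisenstein-resource-bdp-line-w3g19-notes.md` §2, after seat w2 g15's
finding that Raum 2023 Prop. 2.3 — the ramified square-class coupling through the LOWER UNIPOTENT `γ ≡ [1 0; 1 1] (mod q²)` — closes the odd analytic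
residue «`∃ q ∣ m, q ≡ −1 (mod 4p)`»): reading the single-class twist `V_β` (`β = q·v`) at `γ_t = [1 0; q²C 1]`, `C ≡ t (mod q²)`, gives at the
frequency `q·u` the coefficient `c₀(qu)·q⁻¹·ζ·K_{−t̄}(u,v)` with the KLOOSTERMAN SUM `K_s(u,v) = Σ_{x ∈ (ℤ/q)ˣ} ψ(s(u x̄ + v x))` — an IRRATIONAL
algebraic integer, which is the formalisation hazard of Raum's «`K ≢ 0 (mod ℓ)` in `ℤ[ζ_q]`» (his Lemma 2.4). THE TRACE TRICK removes it: summing the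
NF-Q memberships over all units `s` against `ψ(−s j)` produces the RATIONAL INTEGER `q·c_j − (q−1)`, `c_j = #{x ≠ 0 : u x̄ + v x = j}`, and Raum's
counting argument becomes «`c_j ∈ {0,1,2}`, `Σ_j c_j = q − 1`, so some `q·c_j − (q−1)` is prime to any odd `ℓ`»; then `…FlipRungTransport` §5
(rational `x` × INTEGER prime to `p` × unit of `ℤ̄[1/N]` ∈ `p·ℤ̄[1/N]` ⟹ `v_p(x) ≥ 1`) applies verbatim.
* §1 `card_kloostermanFibre_le_two`, `sum_card_kloostermanFibre`; §2 `exists_not_dvd_kloostermanFibreWeight` (the pigeonhole, any odd prime `ℓ`);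
* §3 `sum_stdAddChar_mul_kloosterman_eq` (the trace identity, from the orthogonality `AddChar.sum_mulShift` of `ZMod.stdAddChar`);
* §4 `isIntegral_stdAddChar` and **`norm_ratCast_le_inv_of_kloosterman_memberships`**: if `x·w·K_s(u,v) ∈ p·ℤ̄[1/N]` for every unit `s` (`x ∈ ℚ`,
  `w` a unit of `ℤ̄[1/N]`, `p ∤ N` odd), then `‖x‖_p ≤ p⁻¹` — the reading of the lower-unipotent rung for BOTH Legendre classes at once.
No new definitions, no named facts, no `sorry`. beyond-print theorem: NO (Raum 2023 Lemma 2.4, recast over `ℤ`). BSD is not proved by any of this.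

References: M. Raum, *Relations among Ramanujan-type congruences II*, Forum Math. 35 (2023) 615–646 (arXiv:2105.13170), Prop. 2.3, Lemma 2.4;
[Katz1973] §1.6 Cor. 1.6.2 (the consumer, via NF-Q in T4).
-/

-- summit-side namespace `Summit.BirchSwinnertonDyer.BirchSwinnertonDyer.…` (single-conjunct summit, D-0017 layout)
set_option linter.dupNamespace false

noncomputable section

namespace Summit.BirchSwinnertonDyer.BirchSwinnertonDyer.Theorems.PrintCFram.FlipRung

open Complex Finset Polynomial
open scoped Classical

section Fibres

variable (q : ℕ) [hq : Fact q.Prime]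

/-! ## §1 The fibres of `x ↦ u·x⁻¹ + v·x` on `(ℤ/q)ˣ` -/

/-- **Each fibre has at most two points**: for `v ≠ 0`, `#{x ≠ 0 : u x⁻¹ + v x = j} ≤ 2` (the condition is the quadratic `v x² − j x + u = 0`).
[cite: Raum2023RamanujanTypeII, Lemma 2.4] -/
theorem card_kloostermanFibre_le_two (u v j : ZMod q) (hv : v ≠ 0) :
    (univ.filter (fun x : ZMod q ↦ x ≠ 0 ∧ u * x⁻¹ + v * x = j)).card ≤ 2 := by
  set P : (ZMod q)[X] := C v * X ^ 2 + C (-j) * X + C u with hP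
  have hP0 : P ≠ 0 := by
    intro h
    have := congrArg (fun R : (ZMod q)[X] ↦ R.coeff 2) h
    simp [hP] at this
    exact hv this
  have hdeg : P.natDegree ≤ 2 := by
    rw [hP]
    refine (natDegree_add_le _ _).trans (max_le ((natDegree_add_le _ _).trans (max_le ?_ ?_)) ?_)
    · exact (natDegree_C_mul_le _ _).trans (by simp)
    · exact (natDegree_C_mul_le _ _).trans (by simp)
    · simp
  have hsub : univ.filter (fun x : ZMod q ↦ x ≠ 0 ∧ u * x⁻¹ + v * x = j) ⊆ P.roots.toFinset := by
    intro x hx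
    rw [mem_filter] at hx
    obtain ⟨-, hx0, hxj⟩ := hx
    rw [Multiset.mem_toFinset, mem_roots hP0, IsRoot, hP]
    simp only [eval_add, eval_mul, eval_C, eval_pow, eval_X]
    have : u = j * x - v * x ^ 2 := by
      have h1 : u * x⁻¹ * x = u := by rw [mul_assoc, inv_mul_cancel₀ hx0, mul_one]
      have h2 := congrArg (· * x) hxj
      simp only [add_mul] at h2
      rw [h1] at h2
      linear_combination h2
    rw [this]; ring
  calc (univ.filter (fun x : ZMod q ↦ x ≠ 0 ∧ u * x⁻¹ + v * x = j)).card
      ≤ P.roots.toFinset.card := card_le_card hsub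
    _ ≤ Multiset.card P.roots := Multiset.toFinset_card_le _
    _ ≤ P.natDegree := card_roots' P
    _ ≤ 2 := hdeg

/-- **The fibres partition the `q − 1` units**: `Σ_j #{x ≠ 0 : u x⁻¹ + v x = j} = q − 1`. [cite: Raum2023RamanujanTypeII, Lemma 2.4] -/
theorem sum_card_kloostermanFibre (u v : ZMod q) :
    ∑ j : ZMod q, (univ.filter (fun x : ZMod q ↦ x ≠ 0 ∧ u * x⁻¹ + v * x = j)).card = q - 1 := by
  have hfib := card_eq_sum_card_fiberwise (s := univ.filter (fun x : ZMod q ↦ x ≠ 0)) (t := (univ : Finset (ZMod q)))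
    (f := fun x : ZMod q ↦ u * x⁻¹ + v * x) (fun _ _ ↦ mem_univ _)
  have hne : (univ.filter (fun x : ZMod q ↦ x ≠ 0)).card = q - 1 := by
    rw [filter_ne' univ (0 : ZMod q), card_erase_of_mem (mem_univ _), card_univ, ZMod.card]
  rw [← hne, hfib]
  refine sum_congr rfl fun j _ ↦ ?_
  rw [filter_filter]

/-! ## §2 The pigeonhole: some `q·c_j − (q−1)` is prime to any odd prime -/

/-- **Raum's Lemma 2.4 over `ℤ`.** For `v ≠ 0` and any odd prime `ℓ` there is `j ∈ ℤ/q` with `ℓ ∤ q·c_j − (q − 1)`,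
`c_j = #{x ≠ 0 : u x⁻¹ + v x = j}`: otherwise all `c_j` would be congruent mod `ℓ`, hence equal (`c_j ∈ {0,1,2}`, `ℓ ≥ 3`; for `ℓ = q` the numbers are
`≡ 1`), contradicting `Σ_j c_j = q − 1`. [cite: Raum2023RamanujanTypeII, Lemma 2.4] -/
theorem exists_not_dvd_kloostermanFibreWeight (u v : ZMod q) (hv : v ≠ 0) {ℓ : ℕ} (hℓ : ℓ.Prime) (hℓ2 : ℓ ≠ 2) :
    ∃ j : ZMod q, ¬ ((ℓ : ℤ) ∣ (q : ℤ) * ((univ.filter (fun x : ZMod q ↦ x ≠ 0 ∧ u * x⁻¹ + v * x = j)).card : ℤ) - ((q : ℤ) - 1)) := by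
  have hqp : q.Prime := hq.out
  set c : ZMod q → ℕ := fun j ↦ (univ.filter (fun x : ZMod q ↦ x ≠ 0 ∧ u * x⁻¹ + v * x = j)).card with hc
  by_contra H
  push Not at H
  have hℓ3 : 3 ≤ ℓ := by
    have := hℓ.two_le
    omega
  -- case `ℓ = q`: `q·c_j − (q−1) ≡ 1 (mod q)`
  by_cases hℓq : ℓ = q
  · subst hℓq
    have h0 := H 0
    have : (ℓ : ℤ) ∣ 1 := by
      have h1 : (ℓ : ℤ) ∣ (ℓ : ℤ) * ((c 0 : ℤ) - 1) := dvd_mul_right _ _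
      have := h0.sub h1
      have e : (ℓ : ℤ) * (c 0 : ℤ) - ((ℓ : ℤ) - 1) - (ℓ : ℤ) * ((c 0 : ℤ) - 1) = 1 := by ring
      rwa [e] at this
    have := Int.eq_one_of_dvd_one (by positivity) this
    have := hℓ.one_lt
    omega
  -- case `ℓ ≠ q`: all `c_j` are congruent mod `ℓ`, hence equal
  have hcop : IsCoprime (ℓ : ℤ) (q : ℤ) := by
    rw [Int.isCoprime_iff_gcd_eq_one, Int.gcd_natCast_natCast]
    exact (Nat.coprime_primes hℓ hqp).mpr hℓq
  have heq : ∀ j j' : ZMod q, c j = c j' := by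
    intro j j'
    have hd : (ℓ : ℤ) ∣ (q : ℤ) * ((c j : ℤ) - (c j' : ℤ)) := by
      have := (H j).sub (H j')
      have e : (q : ℤ) * (c j : ℤ) - ((q : ℤ) - 1) - ((q : ℤ) * (c j' : ℤ) - ((q : ℤ) - 1)) = (q : ℤ) * ((c j : ℤ) - (c j' : ℤ)) := by ring
      rwa [e] at this
    have hd' : (ℓ : ℤ) ∣ (c j : ℤ) - (c j' : ℤ) := hcop.dvd_of_dvd_mul_left hd
    have hb1 : c j ≤ 2 := card_kloostermanFibre_le_two q u v j hv
    have hb2 : c j' ≤ 2 := card_kloostermanFibre_le_two q u v j' hv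
    have habs : |(c j : ℤ) - (c j' : ℤ)| < (ℓ : ℤ) := by
      rw [abs_lt]; constructor <;> omega
    have := Int.eq_zero_of_abs_lt_dvd hd' habs
    omega
  have hsum := sum_card_kloostermanFibre q u v
  have hconst : ∑ j : ZMod q, c j = q * c 0 := by
    rw [sum_congr rfl fun j _ ↦ heq j 0, sum_const, card_univ, ZMod.card, smul_eq_mul]
  rw [hconst] at hsum
  have h1 := hqp.one_lt
  rcases Nat.eq_zero_or_pos (c 0) with h0 | h0
  · rw [h0, mul_zero] at hsum; omega
  · have : q * c 0 ≥ q := Nat.le_mul_of_pos_right q h0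
    omega

/-! ## §3 The trace identity `Σ_{s≠0} ψ(−sj)·K_s(u,v) = q·c_j − (q−1)` -/

/-- Orthogonality over the nonzero multipliers: `Σ_{s ≠ 0} ψ(s·a) = q·[a = 0] − 1` for the standard additive character `ψ` of `ℤ/q`.
[folklore] -/
theorem sum_stdAddChar_mul_ne_zero (a : ZMod q) :
    ∑ s : ZMod q, (if s = 0 then (0 : ℂ) else ZMod.stdAddChar (s * a)) = (if a = 0 then (q : ℂ) else 0) - 1 := by
  have hprim := ZMod.isPrimitive_stdAddChar q
  have h := AddChar.sum_mulShift a hprim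
  rw [ZMod.card] at h
  have hpt : ∀ s : ZMod q, (if s = 0 then (0 : ℂ) else ZMod.stdAddChar (s * a)) =
      ZMod.stdAddChar (s * a) - if s = 0 then 1 else 0 := by
    intro s
    split_ifs with hs
    · rw [hs, zero_mul, AddChar.map_zero_eq_one, sub_self]
    · rw [sub_zero]
  simp_rw [hpt, sum_sub_distrib, h, sum_ite_eq' univ (0 : ZMod q), if_pos (mem_univ _)]
  split_ifs <;> simp

/-- **THE TRACE IDENTITY.** With `K_s(u,v) = Σ_{x ≠ 0} ψ(s(u x⁻¹ + v x))` (Kloosterman sum) and `c_j = #{x ≠ 0 : u x⁻¹ + v x = j}`: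
`Σ_{s ≠ 0} ψ(−s j)·K_s(u,v) = q·c_j − (q − 1)` — the irrational Kloosterman weights have RATIONAL INTEGER character sums.
[cite: Raum2023RamanujanTypeII, Lemma 2.4] -/
theorem sum_stdAddChar_mul_kloosterman_eq (u v j : ZMod q) :
    ∑ s : ZMod q, (if s = 0 then (0 : ℂ) else ZMod.stdAddChar (-(s * j)) *
        ∑ x : ZMod q, (if x = 0 then (0 : ℂ) else ZMod.stdAddChar (s * (u * x⁻¹ + v * x)))) =
      (q : ℂ) * ((univ.filter (fun x : ZMod q ↦ x ≠ 0 ∧ u * x⁻¹ + v * x = j)).card : ℂ) - ((q : ℂ) - 1) := by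
  -- rewrite each summand as a sum over `x` and swap
  have hswap : ∑ s : ZMod q, (if s = 0 then (0 : ℂ) else ZMod.stdAddChar (-(s * j)) *
        ∑ x : ZMod q, (if x = 0 then (0 : ℂ) else ZMod.stdAddChar (s * (u * x⁻¹ + v * x)))) =
      ∑ x : ZMod q, (if x = 0 then (0 : ℂ) else
        ∑ s : ZMod q, (if s = 0 then (0 : ℂ) else ZMod.stdAddChar (s * (u * x⁻¹ + v * x - j)))) := by
    have h1 : ∀ s : ZMod q, (if s = 0 then (0 : ℂ) else ZMod.stdAddChar (-(s * j)) *
        ∑ x : ZMod q, (if x = 0 then (0 : ℂ) else ZMod.stdAddChar (s * (u * x⁻¹ + v * x)))) =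
        ∑ x : ZMod q, (if x = 0 then (0 : ℂ) else if s = 0 then 0 else ZMod.stdAddChar (s * (u * x⁻¹ + v * x - j))) := by
      intro s
      split_ifs with hs
      · simp
      · rw [mul_sum]
        refine sum_congr rfl fun x _ ↦ ?_
        split_ifs with hx
        · rw [mul_zero]
        · rw [← AddChar.map_add_eq_mul]; congr 1; ring
    rw [sum_congr rfl fun s _ ↦ h1 s, sum_comm]
    refine sum_congr rfl fun x _ ↦ ?_
    split_ifs with hx
    · simp
    · rfl
  rw [hswap]
  have h2 : ∀ x : ZMod q, (if x = 0 then (0 : ℂ) else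
      ∑ s : ZMod q, (if s = 0 then (0 : ℂ) else ZMod.stdAddChar (s * (u * x⁻¹ + v * x - j)))) =
      (if x ≠ 0 ∧ u * x⁻¹ + v * x = j then (q : ℂ) else 0) - (if x = 0 then 0 else 1) := by
    intro x
    by_cases hx : x = 0
    · simp [hx]
    · rw [if_neg hx, sum_stdAddChar_mul_ne_zero q, if_neg hx]
      simp only [sub_eq_zero, ne_eq, hx, not_false_eq_true, true_and]
  have hA : ∑ x : ZMod q, (if x ≠ 0 ∧ u * x⁻¹ + v * x = j then (q : ℂ) else 0) =
      (q : ℂ) * ((univ.filter (fun x : ZMod q ↦ x ≠ 0 ∧ u * x⁻¹ + v * x = j)).card : ℂ) := by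
    rw [← sum_filter, sum_const, nsmul_eq_mul, mul_comm]
  have hB : ∑ x : ZMod q, (if x = 0 then (0 : ℂ) else 1) = (q : ℂ) - 1 := by
    have e : ∀ x : ZMod q, (if x = 0 then (0 : ℂ) else 1) = 1 - (if x = 0 then 1 else 0) := by
      intro x; split_ifs <;> simp
    simp_rw [e, sum_sub_distrib, sum_const, card_univ, ZMod.card, sum_ite_eq' univ (0 : ZMod q), if_pos (mem_univ _),
      nsmul_eq_mul, mul_one]
  rw [sum_congr rfl fun x _ ↦ h2 x, sum_sub_distrib, hA, hB]

end Fibres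

/-! ## §4 The `p`-adic reading of the lower-unipotent rung (rational weight) -/

/-- Values of the standard additive character are algebraic integers (roots of unity: `ψ(a)^q = ψ(q·a) = 1`). [folklore] -/
theorem isIntegral_stdAddChar {q : ℕ} [NeZero q] (a : ZMod q) : IsIntegral ℤ (ZMod.stdAddChar a : ℂ) := by
  have hpow : (ZMod.stdAddChar a : ℂ) ^ q = 1 := by
    rw [← AddChar.map_nsmul_eq_pow, nsmul_eq_mul, ZMod.natCast_self, zero_mul, AddChar.map_zero_eq_one]
  exact IsIntegral.of_pow (Nat.pos_of_ne_zero (NeZero.ne q)) (by rw [hpow]; exact isIntegral_one)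

/-- **THE READING OF THE LOWER-UNIPOTENT RUNG (both Legendre classes at once).** `p` an odd prime, `p ∤ N`; `q` a prime, `u, v ∈ ℤ/q` with `v ≠ 0`;
`x ∈ ℚ` (the coefficient `c₀(qu)`); `w` a unit of `ℤ̄[1/N]` (the normalisation `q⁻¹`, inverse `w'`). If for EVERY `s ≠ 0` the product
`x·w·K_s(u,v)` lies in `p·ℤ̄[1/N]` (`K_s(u,v) = Σ_{x'≠0} ψ(s(u x'⁻¹ + v x'))`; these are the NF-Q memberships at the cusps `γ_t`, `t = −s̄`, with the roots
of unity stripped), then `‖x‖_p ≤ p⁻¹`. PROOF: trace identity (§3) + pigeonhole (§2) + `…FlipRungTransport` §5. [cite: Raum2023RamanujanTypeII, Prop. 2.3] -/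
theorem norm_ratCast_le_inv_of_kloosterman_memberships {q : ℕ} [Fact q.Prime] {p N : ℕ} [hp : Fact p.Prime] (hp2 : p ≠ 2) (hpN : ¬ p ∣ N)
    (u v : ZMod q) (hv : v ≠ 0) {x : ℚ} {w w' : ℂ} (hww : w * w' = 1) (hw' : ∃ i : ℕ, IsIntegral ℤ ((N : ℂ) ^ i * w'))
    (hK : ∀ s : ZMod q, s ≠ 0 → ∃ y : ℂ, (∃ i : ℕ, IsIntegral ℤ ((N : ℂ) ^ i * y)) ∧
      (x : ℂ) * w * ∑ x' : ZMod q, (if x' = 0 then (0 : ℂ) else ZMod.stdAddChar (s * (u * x'⁻¹ + v * x'))) = (p : ℂ) * y) :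
    ‖((x : ℚ) : ℚ_[p])‖ ≤ (p : ℝ)⁻¹ := by
  obtain ⟨j, hj⟩ := exists_not_dvd_kloostermanFibreWeight q u v hv hp.out hp2
  set cj : ℕ := (univ.filter (fun x' : ZMod q ↦ x' ≠ 0 ∧ u * x'⁻¹ + v * x' = j)).card with hcj
  -- the weighted sum of the memberships lies in `p·ℤ̄[1/N]`
  have hmem : ∃ Y : ℂ, (∃ i : ℕ, IsIntegral ℤ ((N : ℂ) ^ i * Y)) ∧
      ∑ s : ZMod q, (if s = 0 then (0 : ℂ) else ZMod.stdAddChar (-(s * j)) *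
        ((x : ℂ) * w * ∑ x' : ZMod q, (if x' = 0 then (0 : ℂ) else ZMod.stdAddChar (s * (u * x'⁻¹ + v * x'))))) = (p : ℂ) * Y := by
    refine exists_eq_natCast_mul_sum _ fun s _ ↦ ?_
    by_cases hs : s = 0
    · rw [if_pos hs]; exact exists_eq_natCast_mul_zero
    · rw [if_neg hs]
      obtain ⟨y, hy, h⟩ := hK s hs
      rw [h]
      exact exists_eq_natCast_mul_mul_left (exists_isIntegral_pow_mul_of_isIntegral (isIntegral_stdAddChar _)) ⟨y, hy, rfl⟩
  obtain ⟨Y, hY, hsum⟩ := hmem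
  -- … and equals `x·w·(q·c_j − (q−1))` by the trace identity
  have htrace := sum_stdAddChar_mul_kloosterman_eq q u v j
  have hlhs : ∑ s : ZMod q, (if s = 0 then (0 : ℂ) else ZMod.stdAddChar (-(s * j)) *
        ((x : ℂ) * w * ∑ x' : ZMod q, (if x' = 0 then (0 : ℂ) else ZMod.stdAddChar (s * (u * x'⁻¹ + v * x'))))) =
      (x : ℂ) * w * ((q : ℂ) * (cj : ℂ) - ((q : ℂ) - 1)) := by
    rw [← htrace, mul_sum]
    refine sum_congr rfl fun s _ ↦ ?_
    split_ifs <;> ring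
  have hx : (x : ℂ) * ((((q : ℤ) * (cj : ℤ) - ((q : ℤ) - 1) : ℤ)) : ℂ) * w = (p : ℂ) ^ 1 * Y := by
    rw [pow_one, ← hsum, hlhs]; push_cast; ring
  have h := le_padicValRat_of_mul_mul_eq_pow_mul hpN hj hww hw' hY hx
  have hlt : ‖((x : ℚ) : ℚ_[p])‖ < 1 := CuspGlue.padicNorm_lt_one_of_padicValRat (by simpa using h)
  have := (Padic.norm_le_pow_iff_norm_lt_pow_add_one ((x : ℚ) : ℚ_[p]) (-1)).mpr (by simpa using hlt)
  simpa using this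


/-! ## §5 (APPENDED) The reading with the roots of unity left in place and the cusps indexed by `t` (`s = −t⁻¹`) -/

/-- `ψ(a)·ψ(−a) = 1` for an additive character. [folklore] -/
theorem stdAddChar_mul_stdAddChar_neg {M : ℕ} [NeZero M] (a : ZMod M) :
    (ZMod.stdAddChar a : ℂ) * ZMod.stdAddChar (-a) = 1 := by
  rw [← AddChar.map_add_eq_mul, add_neg_cancel, AddChar.map_zero_eq_one]

/-- **THE READING, as T8-5 meets it**: the NF-Q memberships at the cusps `γ_t` (`t ≠ 0`) come as
`x · w · ψ_M(a_t) · K_{−t⁻¹}(u,v) ∈ p·ℤ̄[1/N]` with a root of unity `ψ_M(a_t)` (any modulus `M`, any phases `a_t` — (U3)'s `ψ_{q²}((qu+β)·t̄)`) still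
attached and the Kloosterman sum indexed by `s = −t⁻¹`; conclusion `‖x‖_p ≤ p⁻¹` as in `norm_ratCast_le_inv_of_kloosterman_memberships` (strip the root
of unity by `ψ(−a_t)`, an algebraic integer; re-index by the bijection `t ↦ −t⁻¹` of `(ℤ/q)ˣ`). [cite: Raum2023RamanujanTypeII, Prop. 2.3] -/
theorem norm_ratCast_le_inv_of_kloosterman_memberships_twisted {q : ℕ} [Fact q.Prime] {p N : ℕ} [hp : Fact p.Prime] (hp2 : p ≠ 2)
    (hpN : ¬ p ∣ N) (u v : ZMod q) (hv : v ≠ 0) {x : ℚ} {w w' : ℂ} (hww : w * w' = 1) (hw' : ∃ i : ℕ, IsIntegral ℤ ((N : ℂ) ^ i * w'))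
    {M : ℕ} [NeZero M] (a : ZMod q → ZMod M)
    (hK : ∀ t : ZMod q, t ≠ 0 → ∃ y : ℂ, (∃ i : ℕ, IsIntegral ℤ ((N : ℂ) ^ i * y)) ∧
      (x : ℂ) * w * ZMod.stdAddChar (a t) *
        ∑ x' : ZMod q, (if x' = 0 then (0 : ℂ) else ZMod.stdAddChar (-t⁻¹ * (u * x'⁻¹ + v * x'))) = (p : ℂ) * y) :
    ‖((x : ℚ) : ℚ_[p])‖ ≤ (p : ℝ)⁻¹ := by
  refine norm_ratCast_le_inv_of_kloosterman_memberships hp2 hpN u v hv hww hw' fun s hs ↦ ?_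
  -- re-index: `s = −t⁻¹` with `t := −s⁻¹`
  have ht : (-s⁻¹ : ZMod q) ≠ 0 := by
    intro h
    rw [neg_eq_zero, inv_eq_zero] at h
    exact hs h
  obtain ⟨y, hy, h⟩ := hK (-s⁻¹) ht
  have hss : (-(-s⁻¹)⁻¹ : ZMod q) = s := by rw [neg_inv, neg_neg, inv_inv]
  rw [hss] at h
  -- strip the root of unity `ψ(a t)` with `ψ(−a t)`
  refine ⟨y * ZMod.stdAddChar (-a (-s⁻¹)), exists_isIntegral_pow_mul_mul hy
    (exists_isIntegral_pow_mul_of_isIntegral (isIntegral_stdAddChar _)), ?_⟩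
  have e : (x : ℂ) * w * ∑ x' : ZMod q, (if x' = 0 then (0 : ℂ) else ZMod.stdAddChar (s * (u * x'⁻¹ + v * x'))) =
      ((x : ℂ) * w * ZMod.stdAddChar (a (-s⁻¹)) *
        ∑ x' : ZMod q, (if x' = 0 then (0 : ℂ) else ZMod.stdAddChar (s * (u * x'⁻¹ + v * x')))) * ZMod.stdAddChar (-a (-s⁻¹)) := by
    have h1 := stdAddChar_mul_stdAddChar_neg (a (-s⁻¹))
    calc (x : ℂ) * w * ∑ x' : ZMod q, (if x' = 0 then (0 : ℂ) else ZMod.stdAddChar (s * (u * x'⁻¹ + v * x')))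
        = (x : ℂ) * w * (∑ x' : ZMod q, (if x' = 0 then (0 : ℂ) else ZMod.stdAddChar (s * (u * x'⁻¹ + v * x')))) *
            ((ZMod.stdAddChar (a (-s⁻¹)) : ℂ) * ZMod.stdAddChar (-a (-s⁻¹))) := by rw [h1, mul_one]
      _ = _ := by ring
  rw [e, h]; ring

end Summit.BirchSwinnertonDyer.BirchSwinnertonDyer.Theorems.PrintCFram.FlipRung

end
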